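import Mathlib
import HarnessLib
import HarnessLib.Audit
import Summits.MatrixMultiplication.Statement
import Literature.Computability.AlgebraicComplexity.MatrixMultiplicationExponent
import Literature.Computability.AlgebraicComplexity.FlatteningBound
import HarnessLib.Audit.Status.Attr

/-!
Route: GLnSeparatingDesigns

DORMANT since 2026-08-26T06:29:25Z (reconciler: no traction for 8.4 d (last activity item-evidence-added at 2026-08-17T20:07:42Z); parked, not closed — `ledger route dormant route-MatrixMultiplication-GLnSeparatingDesigns --off` to reac) — unstaffed, not closed; items shared with open routes are served there. `ledger route dormant <id> --off` reactivates.

# Route GLnSeparatingDesigns — BCGPU's printed question — half-dimensional TPP designs in GL_n(C)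
with separating degree q^(1+o(1)) give omega = 2

X = BorderHalfDimensionDesigns, the KEY QUESTION that Blasiak–Cohn–Grochow–Pratt–Umans print and
leave open (arXiv:2410.14905 = BlasiakCohnGrochowPrattUmans2024, §4 p. 33: "do there exist three
subsets in GL_n satisfying the TPP, of size at least q^(n²/2−o_n(n)), and admitting separating
polynomials of degree at most q^(1+o_q(1))? If the answer is yes, then ω = 2 (Corollary 2.8)"), in
its border reading (Cor. 2.8, p. 15: "(border-)separating polynomials") and in ε/δ form: for every ε
> 0 some n ≥ 3 carries, for every δ > 0, arbitrarily large q and every tolerance η > 0, finite X, Y,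
Z ⊆ GL_n(ℂ) with the triple product property (embedding form x y⁻¹ y' z⁻¹ = x' z'⁻¹ ⇒ x = x', y =
y', z = z'), each of size ≥ q^(n²/2 − εn), and for every target (x₀, z₀) a polynomial of total
degree ≤ q^(1+δ) in the n² matrix entries whose value at x y⁻¹ y' z⁻¹ is within η of [x = x₀ ∧ y =
y' ∧ z = z₀] (BCGPU Def. 2.1/2.5). It suffices to show X together with the printed price
SeparationDegreeCost (Cor. 2.8 + Thm. 2.6, unvendored: (|X||Y||Z|)^(ω/3) ≤
s^(C(n,2)(ω−2))·C(s+n²,n²) for degree-s separators), and the deciding theorem `closes : X →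
SeparationDegreeCost → MatrixMultiplication` is PROVED (folder ClosesTest.lean, rc 0). Realises
cards u3-four-and-a-half-dimensions (= support FixedGroupBorderDesigns at n = 3),
lie-mixed-real-forms-small-k and su2-separation-degree-incidence-v2 (design directions for X).
Lean: `∀ ε : ℝ, 0 < ε → ∃ n : ℕ, 3 ≤ n ∧ ∀ δ : ℝ, 0 < δ → ∀ q₀ : ℕ, ∃ q : ℕ, q₀ ≤ q ∧ ∀ η : ℝ, 0 < η
→ ∃ X Y Z : Finset (Matrix.GeneralLinearGroup (Fin n) ℂ), (∀ x ∈ X, ∀ x' ∈ X, ∀ y ∈ Y, ∀ y' ∈ Y, ∀ z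
∈ Z, ∀ z' ∈ Z, x * y⁻¹ * y' * z⁻¹ = x' * z'⁻¹ → x = x' ∧ y = y' ∧ z = z') ∧ (q : ℝ) ^ ((n : ℝ) ^ 2 /
2 - ε * n) ≤ (X.card : ℝ) ∧ (q : ℝ) ^ ((n : ℝ) ^ 2 / 2 - ε * n) ≤ (Y.card : ℝ) ∧ (q : ℝ) ^ ((n : ℝ)
^ 2 / 2 - ε * n) ≤ (Z.card : ℝ) ∧ ∀ x₀ ∈ X, ∀ z₀ ∈ Z, ∃ p : MvPolynomial (Fin n × Fin n) ℂ,
(p.totalDegree : ℝ) ≤ (q : ℝ) ^ (1 + δ) ∧ ∀ x ∈ X, ∀ y ∈ Y, ∀ y' ∈ Y, ∀ z ∈ Z, ((x = x₀ ∧ y = y' ∧ z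
= z₀) → ‖MvPolynomial.eval (fun ij : Fin n × Fin n => ((x * y⁻¹ * y' * z⁻¹ :
Matrix.GeneralLinearGroup (Fin n) ℂ) : Matrix (Fin n) (Fin n) ℂ) ij.1 ij.2) p - 1‖ ≤ η) ∧ (¬ (x = x₀
∧ y = y' ∧ z = z₀) → ‖MvPolynomial.eval (fun ij : Fin n × Fin n => ((x * y⁻¹ * y' * z⁻¹ :
Matrix.GeneralLinearGroup (Fin n) ℂ) : Matrix (Fin n) (Fin n) ℂ) ij.1 ij.2) p‖ ≤ η)`

## Assembly
Real-analysis bookkeeping only, PROVED sorry-free as the deciding theorem `closes (h₁ :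
BorderHalfDimensionDesigns) (h₂ : SeparationDegreeCost) : MatrixMultiplication` (folder glue.lean /
ClosesTest.lean, lean check rc 0): if ω := ω(ℂ) = 2 + t > 2 (ω ≤ 3 by omega_le_three'), take ε = t/8
and the n it yields, δ = t/(32n), q ≥ exp(128 n log n/(5t) + 1); with N = ⌈q^(n²/2 − tn/8)⌉ and s =
⌊q^(1+δ)⌋ ≥ 2 the designs feed SeparationDegreeCost, and logs plus C(s+n²,n²) ≤ (s+n²)^(n²) ≤ (s
n²)^(n²) give (5tn/64)·log q ≤ 2n² log n, contradicting the choice of q; ω ≥ 2 is omega_two_le. No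
Literature fact is assumed.

Rationale: WHY THIS LINE. Mechanism (BlasiakCohnGrochowPrattUmans2024 Thm 2.2/2.6, Cor 2.8, Lemma 2.11, Thm C):
a TPP triple in an INFINITE group plus separating functions drawn from finitely many
finite-dimensional representations makes ⟨|X|,|Y|,|Z|⟩ a (border) restriction of ⊕_ρ ⟨dim ρ⟩; in
GL_n(ℂ) the representations seen by degree-s polynomials are the polynomial irreducibles V_λ, |λ| ≤
s, with dim V_λ ≤ s^(C(n,2)) (Lemma 2.7) and Σ dim² = C(s+n², n²), so sizes q^(n²/2−o(n)) at degree
q^(1+o(1)) force ω = 2, and Thm C already reaches q^(dim/2 − Θ(n)) at degree O(q) in U_n — a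
measured two-parameter deficit (Θ(n) → o(n); U_n → GL_n(ℂ)), the authors' own words p. 6 "falls
short of the conditions needed for Theorem B in only two ways". Imported areas: Lie theory /
invariant theory (the design principle of §2.4: X, Z inside subgroups, one bi-invariant polynomial
p₀ on Y⁻¹Y — birth skeleton stub_invariant_data + PROVED exact splitting lemma), polynomial
representation theory of GL_n (Schur–Weyl, DRS straightening: pricing skeleton), real-algebraic
geometry of definite forms (TPP for (L, U_n, U⁺); BCGPU23 Thm 4.7 forces real, non-subvariety sets),
incidence geometry / distinct distances (the kill side: degree q^(2−ε) impossible for the orthogonal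
column design, p. 17 [SV08]). What no prior route does: the 59 open MatrixMultiplication routes host
Cohn–Umans designs in finite abelian groups, S_n, p-adic congruence towers (CongruenceTowerPacking),
discrete nilpotent U_d(ℤ) with weighted degree (NilpotentLieHosts), finite GL_m(F_p) with
Fourier-rank grading (LevelGradedCohnUmans, closed), Gelfand pairs and orbit-harmonics rings — none
types the archimedean reductive host GL_n(ℂ)/U_n where the printed near-miss lives; the tree holds
Thm 2.2 CORRECTED and PROVED (BCGPU2024_thm_2_2_corrected_holds, after refuting the print's TPP
convention) but not Cor 2.8 / Thm 2.6 / Lemma 2.11, which this route files.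

RANKED CRUXES. #2 BorderHalfDimensionDesigns (crux) — BCGPU 2024 §4 key question (p. 33), border
reading (Cor. 2.8 p. 15), ε/δ/η form as in § Thesis: for every ε > 0 some n ≥ 3 admits, for every δ
> 0, arbitrarily large q and every η > 0, TPP (embedding form) subsets X, Y, Z ⊆ GL_n(ℂ) of sizes ≥
q^(n²/2 − εn) with η-approximate separating polynomials of total degree ≤ q^(1+δ) in the matrix
entries for every target (x₀, z₀). [difficulty: open-problem] (why it might fail: arXiv:2410.14905
p.33/p.7: best is q^(n²/4−n/4) in U_n at degree O(q) (Thm C) — Θ(n) short and in the wrong group;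
conjugate-compact triples force a torus K (card lie-mixed), and distinct distances [SV08] force
degree ≥ q^(2−o(1)) for the O_n column design (p.17).) [BlasiakCohnGrochowPrattUmans2024,
arXiv:2410.14905, BlasiakCohnGrochowPrattUmans2023, CohnUmans2003, doi:10.1007/s00493-008-2099-1]
#3 SeparationDegreeCost (crux) — BCGPU 2024 Cor. 2.8 with its border clause (Thm. 2.6), typed for
η-approximate separators (the unvendored printed price the deciding theorem consumes; crux by
plancard policy, cf. CommutativeSchemes.WeightRemoval): for n ≥ 3, s ≥ 2 and N₁, N₂, N₃, if for
every η > 0 there are TPP (embedding form) subsets of GL_n(ℂ) of sizes ≥ N₁, N₂, N₃ with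
η-approximate separating polynomials of total degree ≤ s, then (N₁N₂N₃)^(ω/3) ≤ s^((n(n−1)/2)(ω−2))
· C(s+n², n²), ω = ω(ℂ). [difficulty: XL] (why it might fail: As RENDERED: the print's Thm 2.2 was
false as vendored (TPP quotient vs embedding form — tree BCGPU2024_thm_2_2_false); "polynomial" must
be holomorphic in the n² entries (p.18 fn.3, real count differs by 2); η-families without
analyticity need the closure step (border rank sublevel sets closed).)
[BlasiakCohnGrochowPrattUmans2024, arXiv:2410.14905, CohnUmans2003, FultonHarris1991,
doi:10.1007/BF01392548,
lean:Literature.Computability.AlgebraicComplexity.BCGPU2024_thm_2_2_corrected_holds]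
#9 ExactHalfDimensionDesigns (support) — the EXACT reading of the printed question (honest
separating polynomials, Def. 2.1; sets independent of the tolerance); implies
BorderHalfDimensionDesigns (PROVED in folder Sketch.lean: border_of_exact). [difficulty:
open-problem] [BlasiakCohnGrochowPrattUmans2024, arXiv:2410.14905]
#9 FixedGroupBorderDesigns (support) — §4 bullet 4 of BCGPU 2024 ("a single, fixed infinite group
(say, GL_3)") in the border reading: ONE n ≥ 3 whose GL_n(ℂ) carries, for every δ > 0, arbitrarily
large q and every η > 0, TPP designs of sizes ≥ q^((n²/2)(1−δ)) with η-approximate separators of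
degree ≤ q^(1+δ); card u3-four-and-a-half-dimensions is its n = 3 reading; implies
BorderHalfDimensionDesigns (PROVED in Sketch.lean: border_of_fixed, δ' = min δ (2ε/n)). [difficulty:
open-problem] [BlasiakCohnGrochowPrattUmans2024, arXiv:2410.14905, CohnUmans2003]

TWO-LAYER PLAN. Foreseen glued splits (nothing filed now; birth skeletons in folder bc/, to be
published as Lines/birth.lean): BorderHalfDimensionDesigns ⇐ InvariantDesignData → SplittingLemma →
BorderHalfDimensionDesigns (BCGPU §2.4 / Lemma 2.11 in exact form: TPP designs X ⊆ 𝔛, Z ⊆ ℨ ≤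
GL_n(ℂ) with ONE (𝔛,ℨ)-bi-invariant polynomial p₀ of degree s₀ vanishing on Y⁻¹Y ∖ 1 plus
double-product separators of degree s₁, s₀ + s₁ ≤ q^(1+δ); SplittingLemma PROVED in the skeleton);
SeparationDegreeCost ⇐ HostingLemma → SchurWeylBlocks → ApproxBlockPricing → SeparationDegreeCost
(η-designs make ⟨N₁,N₂,N₃⟩ an η-approximate restriction of the structure tensor of
(Pol_(≤s)(Mat_n))^*; that tensor is a restriction of ⊕_λ ⟨d_λ⟩ with d_λ ≤ s^(C(n,2)), Σ d_λ² ≤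
C(s+n²,n²); approximate restrictions of block matrix multiplication are priced by Σ d_λ^ω;
composition PROVED). FixedGroupBorderDesigns → BorderHalfDimensionDesigns and
ExactHalfDimensionDesigns → BorderHalfDimensionDesigns are proved glue for the two support
way-points.

KILL CRITERIA. SeparationDegreeCost refuted SUBSTANTIVELY (Cor. 2.8 false beyond a convention
repair) closes the route refuted:SeparationDegreeCost (a misstated rendering is repaired by a new
item, as the tree did for Thm 2.2). A theorem "for every n ≥ 3 there are ε, δ > 0 such that TPP
subsets of GL_n(ℂ) of sizes ≥ q^(n²/2−εn) admit no η-uniform separating polynomials of degree ≤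
q^(1+δ) for large q" (= ¬BorderHalfDimensionDesigns, a GL_n separation-degree barrier) closes it
refuted:BorderHalfDimensionDesigns and is catalogued under Literature/Barriers. Partial kills that
force a pivot to the next design class: degree ≥ q^(2−o(1)) for every design inside (L, U_n, U⁺)
with grid/column coordinates (distinct distances, BCGPU p.17); a fixed-n sandwich a_n ≤ c < 3/2
(card su2, n = 2 analogue). ω(ℂ) = 2 proved on any other route moots it; ω(ℂ) > 2 (route
BorderRankLowerBound) refutes X via `closes`.

NOT DECOMPOSED YET. Which Lie triple (non-conjugate real forms with line-sized pairwise
intersections per card lie-mixed-real-forms-small-k, or fractal digit sets in a fixed U_3/GL_3 per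
card u3) realises InvariantDesignData; the discretisation step (BCGPU Lemma 2.11 with border
parameter) as a typed item; the Schur–Weyl pricing of the truncated coordinate bialgebra
(SchurWeylBlocks) and the approximate-restriction pricing (ApproxBlockPricing) as Literature facts —
all layer-2 children once a crux is claimed; the U_n model question (§4 bullets 1–2, size normalised
by complex parameters) is deliberately not typed (its normalisation q^(n²/4) vs q^(n²/2) is
host-specific and it does not feed `closes`).

CHEAPEST FALSIFIER. (1) Audit the rendering of SeparationDegreeCost against Cor. 2.8 p. 15 / Thm 2.6
p. 14 (TPP embedding form; holomorphic polynomials in the n² entries; n ≥ 3, s ≥ 2) — a lookup; the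
tree's refutation of Thm 2.2-as-printed (BCGPUInfiniteGroupsCounterexample.lean) is the template.
(2) For the running-example class (X ⊆ lower unitriangular, Z ⊆ upper unitriangular with q-grid
entries, Y ⊆ U_n or O_n): prove minimal separating degree ≥ c·q² from distinct inner products (BCGPU
Lemma 2.9 remark, Solymosi–Vu doi:10.1007/s00493-008-2099-1) — kills the simplest design class
outright. (3) kit: n = 3, q ∈ {2,3}: minimal degree of separating polynomials for candidate digit
designs by interpolation rank (card u3 item 4). Run this session: none of (2)–(3) (planning seat; BC
probes only).

NUMBERS. Needed (Cor 2.8 p.15): sizes ≥ q^(n²/2 − o_n(n)) each, (border-)separating degree ≤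
q^(1+o_q(1)); impossible: sizes ≥ s^((1−o(1))(n²/2+c)) (would give ω < 2) or degree ≤ q^(1−c) at
those sizes. Achieved: Thm C (p.6, §3): SU_(n/2,n/2)-type construction inside U_n, sizes
q^(n²/4−n/4) = q^(dim/2 − Θ(n)), border-separating degree O(q); running example GL_n(ℝ) (Thm 1.2,
2.10, 2.14): (L, O_n, U⁺), sizes q^((n²−n)/2) resp. q^(n²/2−5n/2), degree O(q²), and q^(2−ε)
impossible for that Y by [SV08]. Pricing: dim V_λ ≤ s^(C(n,2)) for |λ| ≤ s, n ≥ 3, s ≥ 2 (Lemma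
2.7); dim Pol_(≤s)(Mat_n) = C(s+n²,n²). Record ω < 2.371339
(AlmanDuanVassilevskaWilliamsXuXuZhou2025). Graded packing ceiling
(Literature.Barriers.MatrixMultiplication.GradedPackingBound): |X||Y||Z| ≤
(2/(3√3)+o(1))·C(s+n²,n²)^(3/2) — consistent with the required sizes (slack q^(3δn²/2+3εn)), i.e.
the designs must be near-extremal graded packings.

DEFINITION REQUESTS. None now. Cite facts wanted later (layer 2): BCGPU 2024 Thm 2.6 (border version
of Thm 2.2), Lemma 2.7 (dim V_λ ≤ s^(C(n,2))), Lemma 2.11 (splitting), and the DRS/dCEP basis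
theorem (matrix coefficients of Irr_i, i ≤ s, span Pol_(≤s)(GL_n)) — filed by the claiming prover as
`ledger workitem add --kind cite` when SeparationDegreeCost is worked.

Novelty: Searches (2026-08-17): lens corpus frontier.json (60 rows, 2026) + reads.jsonl; `lit read --grep
<OQH pattern>` at page level on arXiv:2605.21738, 2411.15789, 2404.06427, 2410.14905, 2601.08119,
2601.21553, 2606.08363 (+ corpus hits on 2602.12762, 2604.18283); `lit search --hybrid "asymptotic
rank conjecture implies omega equals 2"` (10 docs; CGLVW geometric-ARC paper the only on-topic hit);
`lit papers --grep` (17 held on-topic); `lit citing arxiv:2410.14905` (2 citing works, neither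
answers §4); remote OpenAlex/S2/arXiv rate-limited this session (noted); tree: grep of all 70 Theses
for 2410.14905 (14 files) and of Ideas/ (3 cards), `ledger negatives` (6, none related), `lean
search` for BCGPU decls (Thm 2.2 corrected/proved; Cor 2.8, Thm 2.6, Lemma 2.11 absent).
Nearest prior art found: BlasiakCohnGrochowPrattUmans2024 (arXiv:2410.14905) itself — the question,
the price (Cor 2.8) and the near-miss (Thm C) are theirs; in-hub: cards
u3-four-and-a-half-dimensions (variant), lie-mixed-real-forms-small-k (variant),
su2-separation-degree-incidence-v2 (new-combination), unrouted; nearest ROUTES NilpotentLieHosts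
(U_d(ℤ), weighted degree, enveloping-algebra price) and CongruenceTowerPacking (p-adic finite
shadow).
Delta: the printed GL_n(ℂ) question typed as a crux with its printed price, a PROVED deciding
theorem and checked birth skeletons (exact splitting lemma proved) — the archimedean reductive host
that no existing route files, realising three open cards; open-question-harves  [refs: 2605.21738, 2410.14905, arxiv:2410.14905, BlasiakCohnGrochowPrattUmans2024]

Barriers (technique_class: lie-hosts, separating-polynomials, group-theoretic): - technique_class: lie-hosts, separating-polynomials, group-theoretic
- Literature.Barriers.MatrixMultiplication.QuasirandomBarrier: evaded by hypothesis — it prices TPP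
designs in FINITE groups by Irr(G) (large second-smallest degree kills Lie-type G(F_q)); here G =
GL_n(ℂ) is infinite and R_sep = polynomial representations of degree ≤ s, all of dimension ≤
s^(C(n,2)) (BCGPU24's stated escape, Thm 2.2 / Cor 2.8).
- Literature.Barriers.MatrixMultiplication.NormalizerBarrier: subgroup triples far from
self-normalising miss the packing bound — the designs here are finite SUBSETS (digit/Lie-algebra
grids), not subgroups; n/a except as a guide (the ambient Lie subgroups L, U_n, U⁺ meet the
dimension packing bound, Thm 1.2).
- Literature.Barriers.MatrixMultiplication.GradedPackingBound: applies verbatim with J =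
Pol_(≤s)(Mat_n): volume ≤ 0.385·C(s+n²,n²)^(3/2); the required sizes sit BELOW this ceiling by the
slack q^(3δn²/2 + 3εn), so the barrier does not bite but forces near-extremal graded packings —
recorded in § Numbers as the quantitative target.
- Literature.Barriers.MatrixMultiplication.TricoloredSumFreeBarrier: abelian hosts of bounded
exponent only; GL_n(ℂ) pieces (tori, unipotents) are torsion-free; n/a.
- Literature.Barriers.MatrixMultiplication.NilpotentGroupBarrier: modular slice rank for p-groups of
bounded exponent/class; characteristic 0, infinite host; n/a.
- YoungSubgroupBarrier / UniversalMethodBarrier files (not catalogued as decls): S_n Young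
subgroups, resp.

History (route lifecycle, newest last):
- 2026-08-26T06:29:25Z · DORMANT — reconciler: no traction for 8.4 d (last activity item-evidence-added at 2026-08-17T20:07:42Z); parked, not closed — `ledger route dormant route-MatrixMultiplica (operator:999:6899)

sub-problem: MatrixMultiplication · status: dormant · opened planner-plan-lens3-MatrixMultiplication-oqh-0 2026-08-17T02:29:01Z · rev 1 · ledger route-MatrixMultiplication-GLnSeparatingDesigns
GENERATED by the gate from the ledger (D-0016/17). Provers cite these decls: `theorem foo : Summit.MatrixMultiplication.MatrixMultiplication.Theses.GLnSeparatingDesigns.<Decl> := …` in Summits/MatrixMultiplication/MatrixMultiplication/Theorems/<Name>.lean.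
-/

namespace Summit.MatrixMultiplication.MatrixMultiplication.Theses.GLnSeparatingDesigns

open scoped BigOperators Topology Manifold Classical MeasureTheory ProbabilityTheory Matrix InnerProductSpace ComplexConjugate ContinuousMap
open Filter Set Function TopologicalSpace MeasureTheory

attribute [summit_statement] _root_.MatrixMultiplication

/-- item stmt-MatrixMultiplication-18360 · crux · rank 2 · open · by planner
why it might fail: arXiv:2410.14905 p.33/p.7: best is q^(n²/4−n/4) in U_n at degree O(q) (Thm C) — Θ(n) short and in the wrong group; conjugate-compact triples force a torus K (card lie-mixed), and distinct distances [SV08] force degree ≥ q^(2−o(1)) for the O_n column design (p.17).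
sources: BlasiakCohnGrochowPrattUmans2024, arXiv:2410.14905, BlasiakCohnGrochowPrattUmans2023, CohnUmans2003, doi:10.1007/s00493-008-2099-1
[crux] BCGPU 2024 §4 key question (p. 33), border reading (Cor. 2.8 p. 15), ε/δ/η form as in §
Thesis: for every ε > 0 some n ≥ 3 admits, for every δ > 0, arbitrarily large q and every η > 0, TPP
(embedding form) subsets X, Y, Z ⊆ GL_n(ℂ) of sizes ≥ q^(n²/2 − εn) with η-approximate separating
polynomials of total degree ≤ q^(1+δ) in the matrix entries for every target (x₀, z₀). [difficulty:
open-problem] -/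
@[route_item "route-MatrixMultiplication-GLnSeparatingDesigns", crux]
def BorderHalfDimensionDesigns : Prop :=
  ∀ ε : ℝ, 0 < ε → ∃ n : ℕ, 3 ≤ n ∧ ∀ δ : ℝ, 0 < δ → ∀ q₀ : ℕ, ∃ q : ℕ, q₀ ≤ q ∧ ∀ η : ℝ, 0 < η → ∃ X Y Z : Finset (Matrix.GeneralLinearGroup (Fin n) ℂ), (∀ x ∈ X, ∀ x' ∈ X, ∀ y ∈ Y, ∀ y' ∈ Y, ∀ z ∈ Z, ∀ z' ∈ Z, x * y⁻¹ * y' * z⁻¹ = x' * z'⁻¹ → x = x' ∧ y = y' ∧ z = z') ∧ (q : ℝ) ^ ((n : ℝ) ^ 2 / 2 - ε * n) ≤ (X.card : ℝ) ∧ (q : ℝ) ^ ((n : ℝ) ^ 2 / 2 - ε * n) ≤ (Y.card : ℝ) ∧ (q : ℝ) ^ ((n : ℝ) ^ 2 / 2 - ε * n) ≤ (Z.card : ℝ) ∧ ∀ x₀ ∈ X, ∀ z₀ ∈ Z, ∃ p : MvPolynomial (Fin n × Fin n) ℂ, (p.totalDegree : ℝ) ≤ (q : ℝ) ^ (1 +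 δ) ∧ ∀ x ∈ X, ∀ y ∈ Y, ∀ y' ∈ Y, ∀ z ∈ Z, ((x = x₀ ∧ y = y' ∧ z = z₀) → ‖MvPolynomial.eval (fun ij : Fin n × Fin n => ((x * y⁻¹ * y' * z⁻¹ : Matrix.GeneralLinearGroup (Fin n) ℂ) : Matrix (Fin n) (Fin n) ℂ) ij.1 ij.2) p - 1‖ ≤ η) ∧ (¬ (x = x₀ ∧ y = y' ∧ z = z₀) → ‖MvPolynomial.eval (fun ij : Fin n × Fin n => ((x * y⁻¹ * y' * z⁻¹ : Matrix.GeneralLinearGroup (Fin n) ℂ) : Matrix (Fin n) (Fin n) ℂ) ij.1 ij.2) p‖ ≤ η)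

/-- item stmt-MatrixMultiplication-18361 · crux · rank 3 · closed · proved by Summit.MatrixMultiplication.MatrixMultiplication.Theorems.SeparationDegreeCost_of @ 1411750fe064 (prover) · by planner
why it might fail: As RENDERED: the print's Thm 2.2 was false as vendored (TPP quotient vs embedding form — tree BCGPU2024_thm_2_2_false); "polynomial" must be holomorphic in the n² entries (p.18 fn.3, real count differs by 2); η-families without analyticity need the closure step (border rank sublevel sets closed).
sources: BlasiakCohnGrochowPrattUmans2024, arXiv:2410.14905, CohnUmans2003, FultonHarris1991, doi:10.1007/BF01392548, lean:Literature.Computability.AlgebraicComplexity.BCGPU2024_thm_2_2_corrected_holds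
[crux] BCGPU 2024 Cor. 2.8 with its border clause (Thm. 2.6), typed for η-approximate separators
(the unvendored printed price the deciding theorem consumes; crux by plancard policy, cf.
CommutativeSchemes.WeightRemoval): for n ≥ 3, s ≥ 2 and N₁, N₂, N₃, if for every η > 0 there are TPP
(embedding form) subsets of GL_n(ℂ) of sizes ≥ N₁, N₂, N₃ with η-approximate separating polynomials
of total degree ≤ s, then (N₁N₂N₃)^(ω/3) ≤ s^((n(n−1)/2)(ω−2)) · C(s+n², n²), ω = ω(ℂ). [difficulty:
XL] -/
@[route_item "route-MatrixMultiplication-GLnSeparatingDesigns", crux]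
def SeparationDegreeCost : Prop :=
  ∀ n : ℕ, 3 ≤ n → ∀ s : ℕ, 2 ≤ s → ∀ N₁ N₂ N₃ : ℕ, (∀ η : ℝ, 0 < η → ∃ X Y Z : Finset (Matrix.GeneralLinearGroup (Fin n) ℂ), N₁ ≤ X.card ∧ N₂ ≤ Y.card ∧ N₃ ≤ Z.card ∧ (∀ x ∈ X, ∀ x' ∈ X, ∀ y ∈ Y, ∀ y' ∈ Y, ∀ z ∈ Z, ∀ z' ∈ Z, x * y⁻¹ * y' * z⁻¹ = x' * z'⁻¹ → x = x' ∧ y = y' ∧ z = z') ∧ ∀ x₀ ∈ X, ∀ z₀ ∈ Z, ∃ p : MvPolynomial (Fin n × Fin n) ℂ, p.totalDegree ≤ s ∧ ∀ x ∈ X, ∀ y ∈ Y, ∀ y' ∈ Y, ∀ z ∈ Z, ((x = x₀ ∧ y = y' ∧ z = z₀) → ‖MvPolynomial.eval (fun ij : Fin n × Fin n => ((x * y⁻¹ * y' * z⁻¹ : Matrix.GeneralLinearGroup (Fin n) ℂ) : Matrix (Fin n) (Fin n) ℂ) ij.1 ij.2) p - 1‖ ≤ η) ∧ (¬ (x = x₀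 ∧ y = y' ∧ z = z₀) → ‖MvPolynomial.eval (fun ij : Fin n × Fin n => ((x * y⁻¹ * y' * z⁻¹ : Matrix.GeneralLinearGroup (Fin n) ℂ) : Matrix (Fin n) (Fin n) ℂ) ij.1 ij.2) p‖ ≤ η)) → ((N₁ : ℝ) * N₂ * N₃) ^ (Literature.Computability.AlgebraicComplexity.omega ℂ / 3) ≤ (s : ℝ) ^ ((n : ℝ) * (n - 1) / 2 * (Literature.Computability.AlgebraicComplexity.omega ℂ - 2)) * ((s + n ^ 2).choose (n ^ 2) : ℝ)

-- `SeparationDegreeCost` holds: proved by `Summit.MatrixMultiplication.MatrixMultiplication.Theorems.SeparationDegreeCost_of` @ 1411750fe064 (its module imports this route file, so no `_holds` link can be stated here).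

/-- item stmt-MatrixMultiplication-18362 · support · rank 9 · open · by planner
sources: BlasiakCohnGrochowPrattUmans2024, arXiv:2410.14905
[support] the EXACT reading of the printed question (honest separating polynomials, Def. 2.1; sets
independent of the tolerance); implies BorderHalfDimensionDesigns (PROVED in folder Sketch.lean:
border_of_exact). [difficulty: open-problem] -/
@[route_item "route-MatrixMultiplication-GLnSeparatingDesigns", crux]
def ExactHalfDimensionDesigns : Prop :=
  ∀ ε : ℝ, 0 < ε → ∃ n : ℕ, 3 ≤ n ∧ ∀ δ : ℝ, 0 < δ → ∀ q₀ : ℕ, ∃ q : ℕ, q₀ ≤ q ∧ ∃ X Y Z : Finset (Matrix.GeneralLinearGroup (Fin n) ℂ), (∀ x ∈ X, ∀ x' ∈ X, ∀ y ∈ Y, ∀ y' ∈ Y, ∀ z ∈ Z, ∀ z' ∈ Z, x * y⁻¹ * y' * z⁻¹ = x' * z'⁻¹ → x = x' ∧ y = y' ∧ z = z') ∧ (q : ℝ) ^ ((n : ℝ) ^ 2 / 2 - ε * n) ≤ (X.card : ℝ) ∧ (q : ℝ) ^ ((n : ℝ) ^ 2 / 2 - ε * n) ≤ (Y.card : ℝ)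 ∧ (q : ℝ) ^ ((n : ℝ) ^ 2 / 2 - ε * n) ≤ (Z.card : ℝ) ∧ ∀ x₀ ∈ X, ∀ z₀ ∈ Z, ∃ p : MvPolynomial (Fin n × Fin n) ℂ, (p.totalDegree : ℝ) ≤ (q : ℝ) ^ (1 + δ) ∧ ∀ x ∈ X, ∀ y ∈ Y, ∀ y' ∈ Y, ∀ z ∈ Z, ((x = x₀ ∧ y = y' ∧ z = z₀) → MvPolynomial.eval (fun ij : Fin n × Fin n => ((x * y⁻¹ * y' * z⁻¹ : Matrix.GeneralLinearGroup (Fin n) ℂ) : Matrix (Fin n) (Fin n) ℂ) ij.1 ij.2) p = 1) ∧ (¬ (x = x₀ ∧ y = y' ∧ z = z₀) → MvPolynomial.eval (fun ij : Fin n × Fin n => ((x * y⁻¹ * y' * z⁻¹ : Matrix.GeneralLinearGroup (Fin n) ℂ) : Matrix (Fin n) (Fin n) ℂ) ij.1 ij.2) p = 0)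

/-- item stmt-MatrixMultiplication-18363 · support · rank 9 · open · by planner
sources: BlasiakCohnGrochowPrattUmans2024, arXiv:2410.14905, CohnUmans2003
[support] §4 bullet 4 of BCGPU 2024 ("a single, fixed infinite group (say, GL_3)") in the border
reading: ONE n ≥ 3 whose GL_n(ℂ) carries, for every δ > 0, arbitrarily large q and every η > 0, TPP
designs of sizes ≥ q^((n²/2)(1−δ)) with η-approximate separators of degree ≤ q^(1+δ); card
u3-four-and-a-half-dimensions is its n = 3 reading; implies BorderHalfDimensionDesigns (PROVED in
Sketch.lean: border_of_fixed, δ' = min δ (2ε/n)). [difficulty: open-problem] -/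
@[route_item "route-MatrixMultiplication-GLnSeparatingDesigns", crux]
def FixedGroupBorderDesigns : Prop :=
  ∃ n : ℕ, 3 ≤ n ∧ ∀ δ : ℝ, 0 < δ → ∀ q₀ : ℕ, ∃ q : ℕ, q₀ ≤ q ∧ ∀ η : ℝ, 0 < η → ∃ X Y Z : Finset (Matrix.GeneralLinearGroup (Fin n) ℂ), (∀ x ∈ X, ∀ x' ∈ X, ∀ y ∈ Y, ∀ y' ∈ Y, ∀ z ∈ Z, ∀ z' ∈ Z, x * y⁻¹ * y' * z⁻¹ = x' * z'⁻¹ → x = x' ∧ y = y' ∧ z = z') ∧ (q : ℝ) ^ ((n : ℝ) ^ 2 / 2 * (1 - δ)) ≤ (X.card : ℝ) ∧ (q : ℝ) ^ ((n : ℝ) ^ 2 / 2 * (1 - δ)) ≤ (Y.card : ℝ) ∧ (q : ℝ) ^ ((n : ℝ) ^ 2 / 2 * (1 - δ)) ≤ (Z.card : ℝ) ∧ ∀ x₀ ∈ X, ∀ z₀ ∈ Z, ∃ p : MvPolynomial (Fin n × Fin n) ℂ, (p.totalDegree : ℝ) ≤ (q : ℝ) ^ (1 + δ) ∧ ∀ x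 ∈ X, ∀ y ∈ Y, ∀ y' ∈ Y, ∀ z ∈ Z, ((x = x₀ ∧ y = y' ∧ z = z₀) → ‖MvPolynomial.eval (fun ij : Fin n × Fin n => ((x * y⁻¹ * y' * z⁻¹ : Matrix.GeneralLinearGroup (Fin n) ℂ) : Matrix (Fin n) (Fin n) ℂ) ij.1 ij.2) p - 1‖ ≤ η) ∧ (¬ (x = x₀ ∧ y = y' ∧ z = z₀) → ‖MvPolynomial.eval (fun ij : Fin n × Fin n => ((x * y⁻¹ * y' * z⁻¹ : Matrix.GeneralLinearGroup (Fin n) ℂ) : Matrix (Fin n) (Fin n) ℂ) ij.1 ij.2) p‖ ≤ η)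

/-- item stmt-MatrixMultiplication-18364 · assembly · rank 1 · closed · proved by Summit.MatrixMultiplication.MatrixMultiplication.Theorems.glnSeparatingDesigns_assembly_proof @ 2f19cff2f77a (prover) · by planner
sources: BlasiakCohnGrochowPrattUmans2024, lean:Literature.Computability.AlgebraicComplexity.omega_two_le
[assembly] BorderHalfDimensionDesigns → SeparationDegreeCost → MatrixMultiplication (= `closes`). -/
@[route_item "route-MatrixMultiplication-GLnSeparatingDesigns"]
def Assembly : Prop :=
  BorderHalfDimensionDesigns → SeparationDegreeCost → MatrixMultiplication

-- `Assembly` holds: proved by `Summit.MatrixMultiplication.MatrixMultiplication.Theorems.glnSeparatingDesigns_assembly_proof` @ 2f19cff2f77a (its module imports this route file, so no `_holds` link can be stated here).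

/-! D-0027 §2.1 — DECIDING THEOREM (planner-authored via `route open/edit --closes-file`; by planner-plan-lens3-MatrixMultiplication-oqh-0 2026-08-17T02:29:01Z):
its hypotheses are this route's items and its conclusion the sub-problem Statement (glue_lint), and it elaborates with this file. -/

/-- DECIDING THEOREM (D-0027 §2.1): the printed question (`BorderHalfDimensionDesigns`, BCGPU 2024 §4 p. 33,
border reading) and the printed price (`SeparationDegreeCost`, BCGPU 2024 Cor. 2.8 / Thm. 2.6) decide
`ω(ℂ) = 2`: if `ω = 2 + t > 2`, take `ε = t/8`, the `n` it yields, `δ = t/(32 n)` and `q ≥ exp(128 n log n/(5t) + 1)`;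
designs of size `N ≥ q^(n²/2 − tn/8)` with separating degree `s ≤ q^(1+δ)` give, by the cost inequality and
`C(s+n²,n²) ≤ (s+n²)^(n²) ≤ (s n²)^(n²)`, `(5tn/64)·log q ≤ 2 n² log n`, contradicting the choice of `q`;
`ω ≥ 2` is the tree's `omega_two_le`. Pure real-analysis bookkeeping, no Literature fact assumed. -/
@[closes "route-MatrixMultiplication-GLnSeparatingDesigns"] theorem closes (h₁ : BorderHalfDimensionDesigns) (h₂ : SeparationDegreeCost) : MatrixMultiplication := by
  rw [_root_.MatrixMultiplication_iff]
  have hω2 : (2 : ℝ) ≤ Literature.Computability.AlgebraicComplexity.omega ℂ :=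
    Literature.Computability.AlgebraicComplexity.omega_two_le ℂ
  have hω3 : Literature.Computability.AlgebraicComplexity.omega ℂ ≤ 3 :=
    Literature.Computability.AlgebraicComplexity.omega_le_three' ℂ
  unfold SeparationDegreeCost at h₂
  generalize hωdef : Literature.Computability.AlgebraicComplexity.omega ℂ = ω at h₂ hω2 hω3 ⊢
  by_contra hne
  have hωgt : 2 < ω := lt_of_le_of_ne hω2 (Ne.symm hne)
  obtain ⟨t, htdef⟩ : ∃ t : ℝ, t = ω - 2 := ⟨_, rfl⟩
  have hωt : ω = 2 + t := by rw [htdef]; ring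
  have htpos : 0 < t := by rw [htdef]; linarith
  have ht1 : t ≤ 1 := by rw [htdef]; linarith
  -- ε := t/8 gives n
  obtain ⟨n, hn3, hn⟩ := h₁ (t / 8) (div_pos htpos (by norm_num))
  have hnpos : (0 : ℝ) < n := by exact_mod_cast (by omega : 0 < n)
  have hn3r : (3 : ℝ) ≤ n := by exact_mod_cast hn3
  have hln : 0 ≤ Real.log n := Real.log_nonneg (by linarith)
  -- δ := t/(32 n), K := 128 n log n /(5 t), q₀ := ⌈exp(K+1)⌉₊
  obtain ⟨δ, hδdef⟩ : ∃ δ : ℝ, δ = t / (32 * n) := ⟨_, rfl⟩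
  have hδpos : 0 < δ := by rw [hδdef]; exact div_pos htpos (by positivity)
  obtain ⟨K, hKdef⟩ : ∃ K : ℝ, K = 128 * n * Real.log n / (5 * t) := ⟨_, rfl⟩
  have hKnn : 0 ≤ K := by
    rw [hKdef]
    exact div_nonneg (mul_nonneg (mul_nonneg (by norm_num) hnpos.le) hln) (by positivity)
  obtain ⟨q, hq₀, hq⟩ := hn δ hδpos ⌈Real.exp (K + 1)⌉₊
  have hqK : Real.exp (K + 1) ≤ q := le_trans (Nat.le_ceil _) (by exact_mod_cast hq₀)
  have hq2 : (2 : ℝ) ≤ q := by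
    have := Real.add_one_le_exp (K + 1)
    linarith
  have hqpos : (0 : ℝ) < q := by linarith
  have hq1 : (1 : ℝ) ≤ q := by linarith
  obtain ⟨L, hLdef⟩ : ∃ L : ℝ, L = Real.log q := ⟨_, rfl⟩
  have hLK : K + 1 ≤ L := by
    have := Real.log_le_log (Real.exp_pos _) hqK
    rwa [Real.log_exp, ← hLdef] at this
  have hLpos : 0 < L := by linarith
  -- degree budget s ≈ q^(1+δ) and common size N ≈ q^a, a := n²/2 − (t/8) n
  obtain ⟨a, hadef⟩ : ∃ a : ℝ, a = (n : ℝ) ^ 2 / 2 - t / 8 * n := ⟨_, rfl⟩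
  have hqδnn : (0 : ℝ) ≤ (q : ℝ) ^ (1 + δ) := Real.rpow_nonneg hqpos.le _
  have hqδ : (q : ℝ) ≤ (q : ℝ) ^ (1 + δ) := by
    have := Real.rpow_le_rpow_of_exponent_le hq1 (show (1 : ℝ) ≤ 1 + δ by linarith)
    rwa [Real.rpow_one] at this
  obtain ⟨s, hs2, hsle, hsdeg⟩ : ∃ s : ℕ, 2 ≤ s ∧ (s : ℝ) ≤ (q : ℝ) ^ (1 + δ) ∧
      ∀ d : ℕ, (d : ℝ) ≤ (q : ℝ) ^ (1 + δ) → d ≤ s :=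
    ⟨⌊(q : ℝ) ^ (1 + δ)⌋₊, Nat.le_floor (by push_cast; linarith), Nat.floor_le hqδnn,
      fun d hd => Nat.le_floor hd⟩
  have hs2r : (2 : ℝ) ≤ s := by exact_mod_cast hs2
  have hspos : (0 : ℝ) < s := by linarith
  have hqa : (0 : ℝ) < (q : ℝ) ^ a := Real.rpow_pos_of_pos hqpos a
  obtain ⟨N, hNge, hNle⟩ : ∃ N : ℕ, (q : ℝ) ^ a ≤ N ∧ ∀ m : ℕ, (q : ℝ) ^ a ≤ m → N ≤ m :=
    ⟨⌈(q : ℝ) ^ a⌉₊, Nat.le_ceil _, fun m hm => Nat.ceil_le.mpr hm⟩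
  have hNpos : (0 : ℝ) < N := lt_of_lt_of_le hqa hNge
  -- apply the cost crux to the designs at every tolerance
  have hcost := h₂ n hn3 s hs2 N N N (by
    intro η hη
    obtain ⟨X, Y, Z, htpp, hX, hY, hZ, hsep⟩ := hq η hη
    rw [← hadef] at hX hY hZ
    refine ⟨X, Y, Z, hNle _ hX, hNle _ hY, hNle _ hZ, htpp, ?_⟩
    intro x₀ hx₀ z₀ hz₀
    obtain ⟨p, hp, hsep'⟩ := hsep x₀ hx₀ z₀ hz₀
    exact ⟨p, hsdeg _ hp, hsep'⟩)
  -- take logarithms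
  have hC : (0 : ℝ) < ((s + n ^ 2).choose (n ^ 2) : ℝ) := by
    exact_mod_cast Nat.choose_pos (Nat.le_add_left _ _)
  have hcnn : 0 ≤ (n : ℝ) * (n - 1) / 2 * (ω - 2) := by
    have : (0 : ℝ) ≤ n - 1 := by linarith
    have : (0 : ℝ) ≤ ω - 2 := by linarith
    positivity
  have hspow : (0 : ℝ) < (s : ℝ) ^ ((n : ℝ) * (n - 1) / 2 * (ω - 2)) := Real.rpow_pos_of_pos hspos _
  have hNNN : (0 : ℝ) < (N : ℝ) * N * N := by positivity
  have hLHSpos : (0 : ℝ) < ((N : ℝ) * N * N) ^ (ω / 3) := Real.rpow_pos_of_pos hNNN _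
  have hlog := Real.log_le_log hLHSpos hcost
  rw [Real.log_rpow hNNN, Real.log_mul hspow.ne' hC.ne', Real.log_rpow hspos] at hlog
  have hN3 : Real.log ((N : ℝ) * N * N) = 3 * Real.log N := by
    rw [show (N : ℝ) * N * N = (N : ℝ) ^ 3 by ring, Real.log_pow]; push_cast; ring
  rw [hN3] at hlog
  -- the four elementary estimates
  have hlogN : a * L ≤ Real.log N := by
    have := Real.log_le_log hqa hNge
    rwa [Real.log_rpow hqpos, ← hLdef] at this
  have hlogs : Real.log s ≤ (1 + δ) * L := by
    have := Real.log_le_log hspos hsle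
    rwa [Real.log_rpow hqpos, ← hLdef] at this
  have hchoose : Real.log ((s + n ^ 2).choose (n ^ 2) : ℝ) ≤
      (n : ℝ) ^ 2 * ((1 + δ) * L + 2 * Real.log n) := by
    have h1 : ((s + n ^ 2).choose (n ^ 2) : ℝ) ≤ ((s : ℝ) + n ^ 2) ^ (n ^ 2) := by
      exact_mod_cast Nat.choose_le_pow (s + n ^ 2) (n ^ 2)
    have h2 : Real.log ((s + n ^ 2).choose (n ^ 2) : ℝ) ≤ (n ^ 2 : ℕ) * Real.log ((s : ℝ) + n ^ 2) := by
      rw [← Real.log_pow]; exact Real.log_le_log hC h1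
    have hn9 : (9 : ℝ) ≤ (n : ℝ) ^ 2 := by
      have h33 : (3 : ℝ) * 3 ≤ (n : ℝ) * n := mul_le_mul hn3r hn3r (by norm_num) (by linarith)
      have e : (n : ℝ) ^ 2 = n * n := by ring
      rw [e]; linarith
    have hA : (1 : ℝ) * 8 ≤ ((s : ℝ) - 1) * ((n : ℝ) ^ 2 - 1) :=
      mul_le_mul (by linarith) (by linarith) (by norm_num) (by linarith)
    have h3 : (s : ℝ) + n ^ 2 ≤ s * n ^ 2 := by
      have e : ((s : ℝ) - 1) * ((n : ℝ) ^ 2 - 1) = s * n ^ 2 - s - n ^ 2 + 1 := by ring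
      rw [e] at hA; linarith
    have hn2pos : (0 : ℝ) < (n : ℝ) ^ 2 := by positivity
    have h4 : Real.log ((s : ℝ) + n ^ 2) ≤ Real.log s + 2 * Real.log n := by
      have := Real.log_le_log (by positivity) h3
      rw [Real.log_mul hspos.ne' hn2pos.ne', Real.log_pow] at this
      push_cast at this; linarith
    have h5 : Real.log ((s : ℝ) + n ^ 2) ≤ (1 + δ) * L + 2 * Real.log n := by linarith
    have h6 : ((n ^ 2 : ℕ) : ℝ) = (n : ℝ) ^ 2 := by push_cast; ring
    rw [h6] at h2
    exact le_trans h2 (mul_le_mul_of_nonneg_left h5 hn2pos.le)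
  have hωnn : 0 ≤ ω := by linarith
  -- main inequality, linear in L after expansion
  have e1 : ω * Real.log N ≤ (n : ℝ) * (n - 1) / 2 * (ω - 2) * Real.log s
      + Real.log ((s + n ^ 2).choose (n ^ 2) : ℝ) := by
    have : ω / 3 * (3 * Real.log N) = ω * Real.log N := by ring
    linarith
  have e2 : ω * (a * L) ≤ ω * Real.log N := mul_le_mul_of_nonneg_left hlogN hωnn
  have e3 : (n : ℝ) * (n - 1) / 2 * (ω - 2) * Real.log s
      ≤ (n : ℝ) * (n - 1) / 2 * (ω - 2) * ((1 + δ) * L) := mul_le_mul_of_nonneg_left hlogs hcnn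
  have main : ω * (a * L) ≤ (n : ℝ) * (n - 1) / 2 * (ω - 2) * ((1 + δ) * L)
      + (n : ℝ) ^ 2 * ((1 + δ) * L + 2 * Real.log n) := by linarith
  -- with ω = 2 + t and a explicit: B * L ≤ 2 n² log n
  have key : (t * n / 4 - t ^ 2 * n / 8 - δ * (t * ((n : ℝ) ^ 2 - n) / 2 + n ^ 2)) * L
      ≤ 2 * n ^ 2 * Real.log n := by
    have e : (t * n / 4 - t ^ 2 * n / 8 - δ * (t * ((n : ℝ) ^ 2 - n) / 2 + n ^ 2)) * L
        = ω * (a * L) - ((n : ℝ) * (n - 1) / 2 * (ω - 2) * ((1 + δ) * L)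
          + (n : ℝ) ^ 2 * ((1 + δ) * L + 2 * Real.log n)) + 2 * n ^ 2 * Real.log n := by
      rw [hωt, hadef]; ring
    rw [e]; linarith
  -- with δ = t/(32 n) the bracket is ≥ 5 t n / 64
  have hB : 5 * t * n / 64 ≤ t * n / 4 - t ^ 2 * n / 8 - δ * (t * ((n : ℝ) ^ 2 - n) / 2 + n ^ 2) := by
    have e : δ * (t * ((n : ℝ) ^ 2 - n) / 2 + n ^ 2) = t * (t * (n - 1) / 2 + n) / 32 := by
      rw [hδdef]; field_simp
    rw [e]
    have e2 : t * n / 4 - t ^ 2 * n / 8 - t * (t * ((n : ℝ) - 1) / 2 + n) / 32 - 5 * t * n / 64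
        = (9 * t * n * (1 - t) + t ^ 2) / 64 := by ring
    have hpos1 : 0 ≤ 9 * t * n * (1 - t) :=
      mul_nonneg (mul_nonneg (mul_nonneg (by norm_num) htpos.le) hnpos.le) (sub_nonneg.2 ht1)
    have hpos2 : 0 ≤ t ^ 2 := sq_nonneg t
    have : 0 ≤ (9 * t * n * (1 - t) + t ^ 2) / 64 := by
      apply div_nonneg _ (by norm_num); linarith
    linarith
  have h5 : 5 * t * n / 64 * L ≤ 2 * n ^ 2 * Real.log n :=
    le_trans (mul_le_mul_of_nonneg_right hB hLpos.le) key
  -- hence 5 t L ≤ 128 n log n, contradicting L ≥ K + 1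
  have h6 : 5 * t * L ≤ 128 * n * Real.log n := by
    have ea : (n : ℝ) * (5 * t * L) = 64 * (5 * t * n / 64 * L) := by ring
    have eb : (n : ℝ) * (128 * n * Real.log n) = 64 * (2 * n ^ 2 * Real.log n) := by ring
    have e : (n : ℝ) * (5 * t * L) ≤ (n : ℝ) * (128 * n * Real.log n) := by rw [ea, eb]; linarith
    exact le_of_mul_le_mul_left e hnpos
  have h7 : 5 * t * (K + 1) ≤ 5 * t * L := mul_le_mul_of_nonneg_left hLK (by positivity)
  have h8 : 5 * t * K = 128 * n * Real.log n := by rw [hKdef]; field_simp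
  have h9 : 0 < 5 * t := by linarith
  have h10 : 5 * t * (K + 1) = 5 * t * K + 5 * t := by ring
  linarith

end Summit.MatrixMultiplication.MatrixMultiplication.Theses.GLnSeparatingDesigns
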